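/-
Copyright (c) 2026 the pub-hodgecm-mathlib formalisation cell (harness21).  Prover seat hodgecm-mathlib-LH4-p13 (g0): Track A «(D-RAM) FOUR-FRAME» squad of crux H413
(dealer LH4-plan (g10) WORD #29 «p13 → (e) `stub_U2H_typeTwoRow_wild`»; LH4-p05 (g0) CENSUS v2 (f) «type dichotomy»), 2026-09-03.
-/
import Literature.NumberTheory.Automorphic.UnitaryTwoRamifiedEllipticFixedModularVertices   -- ★ p847070 (A-p12 (g23)): `setOf_rhoVertexActPlace_eq_self_eq`; brings ★ (W2)-Place `forall_coe_mem_glInt_iff_rhoVertexActPlace_root_eq`, ★ `exists_rhoVertexActPlace_eq'`, ★ B-p14 `ncard_fixedBy_quotient_eq_of_vertexAction`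
import Literature.NumberTheory.Automorphic.UnitaryUnitOrbitalIntegralLatticeCount             -- ★ `natCard_fixedBy_quotient_congr` (transport of fixed cosets along `E₂ = localNonsplitEquiv`)
import HarnessLib

/-!
# The number of SELF-DUAL vertices fixed by an element of `U(Φ₂)` at a ramified place of `√u`-TYPE (anti-fixed UNIT): `#Fix_{γ₂}(U₂ ⧸ K₂) = #{x | g·x = x}`,
# `K₂ = U(Φ₂)(𝒪_v)`, `g` any projective descent of `E₂ γ₂` — the `K₂`-column as a vertex count in the tree of `SL₂(L⁺_v)`
# (Tits 1979 §2.7, §3.2; Serre, *Trees* I §6.1, II §1.3; Kottwitz 1988 §2)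

Topic `NumberTheory/Automorphic`; namespace `Literature.NumberTheory.Automorphic.UnitaryGroup` (as ★ `UnitaryTwoRamifiedEllipticFixedModularVertices`).  THEOREMS ONLY
(no definition, no instance, no notation, no named fact, no `sorry`); kernel lane `--supports stmt-HodgeConjecture-24833`.  Cell `pub/hodgecm-mathlib` (D-0151), crux H413;
Track A «(D-RAM) FOUR-FRAME», unit U2H (ii-H), child (e) `stub_U2H_typeTwoRow_wild` (dealer LH4-plan (g10) WORD #29; LH4-p06 (g0) ED. 4∕5 design (e₀)); the WILD groundwork
under ★ p855119 `F0P3cDyRamHProfilesTypeTwoUnfolding` (`Φ^st(γ_H, hFamily 0) = ν_H(K₂ × U₁) · #Fix_{γ₂}(U₂ ⧸ K₂)` at ANY ramified place).  HONEST LABEL: HC_CM is proved only modulo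
the 7 printed citations (2 remaining named inputs: hLiu418 = stmt-HodgeConjecture-24832, h413 = stmt-HodgeConjecture-24833) until rung 0 closes; nothing printed is asserted here —
transport along ★ theorems; the COUNT of the fixed vertex set (a ball governed by the eigen-order conductor at a dyadic place) is NOT here.

THE MATHEMATICS.  At a ramified non-split `w ∣ v` the anti-fixed elements `α` of `L_w` (`σ_w α = −α`) have valuations `exp(2n − d)` (`d = v_w(𝔇_{w∣v})`, skew parity); so EITHER
an anti-fixed UNIFORMISER exists (`d` odd: every tame place, the wild places of type `L⁺_v(√π)` — the «√π-TYPE» of ★ `UnitaryTwoRamifiedTreeStabilizers` §2) OR an anti-fixed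
UNIT exists (`d` even: the wild places of type `L⁺_v(√u)` — the «√u-TYPE»; e.g. `t₊ = (ϖ − σϖ)(ϖσϖ)^{−d∕2}`, ★ `v_refSkewScalar`), never both.  With `D_α = diag(1, α)` the
projective descent `D_α · E₂(γ₂) · D_α⁻¹ = s · ι_w(g)` (★ `exists_conj_diagonal_eq_smul_map_toPlace`, any anti-fixed `α ≠ 0`) lets `U_w = U(σ_w, (Φ₂)_w)(L_w)` act on the tree of
`SL₂(L⁺_v)` (★ `rhoVertexActPlace`), TRANSITIVELY on vertices at a ramified place (★ `exists_rhoVertexActPlace_eq'`, no valuation constraint on `α`).  At a √u-TYPE place the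
integral level `U_w ∩ GL₂(𝒪_w)` is the stabiliser of the ROOT VERTEX `v₀ = 𝒪_v²` (★ (W2)-Place `forall_coe_mem_glInt_iff_rhoVertexActPlace_root_eq`, `|α| = 1`) — whereas at a
√π-type place it is the stabiliser of an EDGE and `K♯` that of a vertex (★ p847070's column): the two profile columns of ★ DEFS LEAF №5 `hFamily` SWAP their tree meaning with the
type.  Hence, by the orbit–stabiliser transport ★ `ncard_fixedBy_quotient_eq_of_vertexAction`: `#Fix_u(U_w ⧸ (U_w ∩ GL₂(𝒪_w))) = #{x | ρ_w(u)·x = x} = #{x | g·x = x}` for any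
descent representative `g` (★ `setOf_rhoVertexActPlace_eq_self_eq`); and on the CM carrier `U₂ = U(Φ₂)(L⁺_v)`, `#Fix_{γ₂}(U₂ ⧸ K₂) = #Fix_{E₂γ₂}(U_w ⧸ (U_w ∩ GL₂(𝒪_w)))`
(★ `mem_localIntegralLevel_iff_of_smul_eq`, ★ `natCard_fixedBy_quotient_congr`).

* §1 `ncard_fixedBy_quotient_comap_glInt_eq_ncard_setOf_glVertexAct` — one-place model, √u-type: the `GL₂(𝒪_w)`-coset count is the fixed-vertex count.
* §2 `natCard_fixedBy_cmLocalIntegralLevel_eq_ncard_fixedBy_onePlace` — transport `U₂ ⧸ K₂ → U_w ⧸ (U_w ∩ GL₂(𝒪_w))` (any non-split place).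
* §3 **`natCard_fixedBy_cmLocalIntegralLevel_eq_ncard_setOf_glVertexAct_of_v_eq_one`** — THE HEAD: `#Fix_{γ₂}(U₂ ⧸ K₂) = #{x | g·x = x}` at a √u-type ramified place.

## References
* [Tits1979] J. Tits, *Reductive groups over local fields*, PSPM 33.1 (1979), §2.7 p. 48, §3.2 p. 50 (quasi-split `U(1,1)`: the building is the tree of `SL₂`; maximal
  bounded subgroups = vertex and edge stabilisers).
* [Serre1980Trees] J.-P. Serre, *Trees* (1980), Ch. I §6.1 (orbit–stabiliser), Ch. II §1.1–§1.3 (the tree of `SL₂` over a local field).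
* [Kottwitz1988] R. E. Kottwitz, *Tamagawa numbers*, Ann. of Math. 127 (1988), §2 (orbital integrals of indicators as fixed-coset counts).
* [LabesseLanglands1979] J.-P. Labesse, R. P. Langlands, *L-indistinguishability for SL(2)*, Canad. J. Math. 31 (1979), §2 p. 8 (fixed balls of elliptic tori).
-/

set_option autoImplicit false

noncomputable section

open scoped WithZero ValuativeRel Matrix MatrixGroups
open Matrix WithZero ValuativeRel NumberField IsDedekindDomain MulAction

namespace Literature.NumberTheory.Automorphic.UnitaryGroup

open Literature.NumberTheory.Automorphic Literature.NumberTheory.Automorphic.HermitianLatticeTree Literature.GroupTheory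

section Place

variable (L : Type) [Field L] [NumberField L] [IsCMField L] (v : HeightOneSpectrum (𝓞 ↥(maximalRealSubfield L)))
  (w : PlacesOver L v) (hw : IsCMField.complexConj L • w.1 = w.1)
  {α : w.1.adicCompletion L} (hα : galAdicCompletionMap (L := L) (IsCMField.complexConj L) hw α = -α) (hα0 : α ≠ 0)
  {ϖF : v.adicCompletion ↥(maximalRealSubfield L)} (hϖF : Valued.v ϖF = exp (-1 : ℤ))

/-! ## §1 The `GL₂(𝒪_w)`-coset count as a tree count at a √u-type place -/

include hα hα0 in
/-- **THE `K₂`-COSET COUNT IS A VERTEX COUNT AT A √u-TYPE RAMIFIED PLACE** (`α` an anti-fixed UNIT, `|α| = 1`): for EVERY `u ∈ U_w` and any descent representative `(s, g)`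
(`diag(1,α) u diag(1,α)⁻¹ = s · ι_w(g)`), `#Fix_u(U_w ⧸ (U_w ∩ GL₂(𝒪_w))) = #{x | g·x = x}` (`Set.ncard`; `GL₂(𝒪_w)` pulled back along the inclusion `U_w ≤ GL₂(L_w)`) — vertex-transitivity
★ `exists_rhoVertexActPlace_eq'`, root stabiliser ★ (W2)-Place `forall_coe_mem_glInt_iff_rhoVertexActPlace_root_eq`, transport ★ B-p14, and ★ `setOf_rhoVertexActPlace_eq_self_eq`.
The √u-type twin of ★ `ncard_fixedBy_quotient_comap_modular_eq_ncard_setOf_glVertexAct` (there: √π-type, `K♯`, base vertex `v₁`).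
[cite: Serre1980Trees, Ch. I §6.1; Ch. II §1.3] [cite: Tits1979, §3.2 p. 50] [cite: Kottwitz1988, §2] -/
theorem ncard_fixedBy_quotient_comap_glInt_eq_ncard_setOf_glVertexAct (he : v.asIdeal.ramificationIdx' w.1.asIdeal ≠ 1) (hvα : Valued.v α = 1)
    (u : ↥(unitaryGroupOfForm (galAdicCompletionMap (L := L) (IsCMField.complexConj L) hw)
      (placeForm (Matrix.of fun i j : Fin 2 => if i.val + j.val + 1 = 2 then (1 : L) else 0) w.1)))
    {s : w.1.adicCompletion L} {g : GL (Fin 2) (v.adicCompletion ↥(maximalRealSubfield L))} (hs : s ≠ 0)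
    (hsg : Matrix.diagonal ![1, α] * ((u : GL (Fin 2) (w.1.adicCompletion L)) : Matrix (Fin 2) (Fin 2) (w.1.adicCompletion L)) * Matrix.diagonal ![1, α⁻¹] =
      s • (g : Matrix (Fin 2) (Fin 2) (v.adicCompletion ↥(maximalRealSubfield L))).map (toPlace v w)) :
    (fixedBy (↥(unitaryGroupOfForm (galAdicCompletionMap (L := L) (IsCMField.complexConj L) hw)
        (placeForm (Matrix.of fun i j : Fin 2 => if i.val + j.val + 1 = 2 then (1 : L) else 0) w.1)) ⧸
        ((glInt 2 (w.1.adicCompletion L)).comap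
          (unitaryGroupOfForm (galAdicCompletionMap (L := L) (IsCMField.complexConj L) hw)
            (placeForm (Matrix.of fun i j : Fin 2 => if i.val + j.val + 1 = 2 then (1 : L) else 0) w.1)).subtype)) u).ncard =
      {x : {M : Submodule 𝒪[v.adicCompletion ↥(maximalRealSubfield L)] (Fin 2 → v.adicCompletion ↥(maximalRealSubfield L)) //
        IsSpecialLattice (RingHom.id _) ϖF !![(0 : v.adicCompletion ↥(maximalRealSubfield L)), 1; -1, 0] M} |
          glVertexAct (isUniformizingElement_of_v_eq hϖF) g x = x}.ncard := by
  haveI : IsDiscreteValuationRing 𝒪[v.adicCompletion ↥(maximalRealSubfield L)] := isDiscreteValuationRing_integer_of_compatible hϖF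
  -- the base vertex `v₀ = latt 1` (the self-dual root)
  have hsd : IsSpecialLattice (RingHom.id _) ϖF !![(0 : v.adicCompletion ↥(maximalRealSubfield L)), 1; -1, 0]
      (latt (1 : Matrix (Fin 2) (Fin 2) (v.adicCompletion ↥(maximalRealSubfield L)))) :=
    Or.inl ((isSelfDualLattice_id_altJ_iff _).2 ⟨1, by rw [Units.val_one], by rw [Units.val_one, det_one, map_one]⟩)
  set v₀ : {M : Submodule 𝒪[v.adicCompletion ↥(maximalRealSubfield L)] (Fin 2 → v.adicCompletion ↥(maximalRealSubfield L)) //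
      IsSpecialLattice (RingHom.id _) ϖF !![(0 : v.adicCompletion ↥(maximalRealSubfield L)), 1; -1, 0] M} := ⟨_, hsd⟩ with hv₀def
  have hv₀ : v₀.1 = latt (1 : Matrix (Fin 2) (Fin 2) (v.adicCompletion ↥(maximalRealSubfield L))) := rfl
  -- stabiliser dictionary (√u-type root head) and transitivity
  have hKv := forall_coe_mem_glInt_iff_rhoVertexActPlace_root_eq L v w hw hα hα0 hϖF v₀ hv₀ hvα
  have hV : ∀ x, ∃ u' : ↥(unitaryGroupOfForm (galAdicCompletionMap (L := L) (IsCMField.complexConj L) hw)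
      (placeForm (Matrix.of fun i j : Fin 2 => if i.val + j.val + 1 = 2 then (1 : L) else 0) w.1)), rhoVertexActPlace L v w hw hα hα0 hϖF u' v₀ = x :=
    fun x => exists_rhoVertexActPlace_eq' L v w hw hα hα0 hϖF he v₀ x
  rw [ncard_fixedBy_quotient_eq_of_vertexAction (rhoVertexActPlace L v w hw hα hα0 hϖF) (rhoVertexActPlace_one L v w hw hα hα0 hϖF)
    (rhoVertexActPlace_mul L v w hw hα hα0 hϖF) hV _ (fun g' => by rw [Subgroup.mem_comap, Subgroup.coe_subtype]; exact hKv g') u,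
    setOf_rhoVertexActPlace_eq_self_eq L v w hw hα hα0 hϖF u hs hsg]

/-! ## §2 Transport from the CM carrier `U₂ = U(Φ₂)(L⁺_v)` to the one-place model -/

include hw in
/-- **TRANSPORT TO `U_w`** (any non-split place): `#Fix_{γ₂}(U₂ ⧸ K₂) = #Fix_{E₂ γ₂}(U_w ⧸ (U_w ∩ GL₂(𝒪_w)))` for the integral level `K₂ = U(Φ₂)(𝒪_v)` (★ `cmLocalIntegralLevel`), matched by
`E₂ = localNonsplitEquiv` with `GL₂(𝒪_w)` (★ `mem_localIntegralLevel_iff_of_smul_eq`); ★ `natCard_fixedBy_quotient_congr`, `Set.ncard` on the right. [cite: Kottwitz1988, §2]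
[cite: Serre1980Trees, Ch. I §6.1] -/
theorem natCard_fixedBy_cmLocalIntegralLevel_eq_ncard_fixedBy_onePlace
    (γ₂ : ((cmDatum L 2 (Matrix.of fun i j : Fin 2 => if i.val + j.val + 1 = 2 then (1 : L) else 0)).Local v)) :
    Nat.card (fixedBy (((cmDatum L 2 (Matrix.of fun i j : Fin 2 => if i.val + j.val + 1 = 2 then (1 : L) else 0)).Local v) ⧸
        cmLocalIntegralLevel L 2 (Matrix.of fun i j : Fin 2 => if i.val + j.val + 1 = 2 then (1 : L) else 0) v) γ₂) =
      (fixedBy (↥(unitaryGroupOfForm (galAdicCompletionMap (L := L) (IsCMField.complexConj L) hw)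
          (placeForm (Matrix.of fun i j : Fin 2 => if i.val + j.val + 1 = 2 then (1 : L) else 0) w.1)) ⧸
          ((glInt 2 (w.1.adicCompletion L)).comap
            (unitaryGroupOfForm (galAdicCompletionMap (L := L) (IsCMField.complexConj L) hw)
              (placeForm (Matrix.of fun i j : Fin 2 => if i.val + j.val + 1 = 2 then (1 : L) else 0) w.1)).subtype))
        ((localNonsplitEquiv (IsCMField.complexConj L) (Matrix.of fun i j : Fin 2 => if i.val + j.val + 1 = 2 then (1 : L) else 0) (IsCMField.complexConj_ne_one L) w hw) γ₂)).ncard := by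
  rw [← Nat.card_coe_set_eq]
  exact natCard_fixedBy_quotient_congr _ _
    (localNonsplitEquiv (IsCMField.complexConj L) (Matrix.of fun i j : Fin 2 => if i.val + j.val + 1 = 2 then (1 : L) else 0) (IsCMField.complexConj_ne_one L) w hw).toMulEquiv
    (fun g => by
      rw [Subgroup.mem_comap, Subgroup.coe_subtype]
      exact mem_localIntegralLevel_iff_of_smul_eq (IsCMField.complexConj L) 2 (Matrix.of fun i j : Fin 2 => if i.val + j.val + 1 = 2 then (1 : L) else 0)
        (IsCMField.complexConj_ne_one L) w hw g) γ₂

/-! ## §3 The head: the `K₂`-column of the CM carrier at a √u-type ramified place -/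

include hα hα0 in
/-- **THE SELF-DUAL FIXED-COSET COUNT AT A √u-TYPE RAMIFIED PLACE IS A FIXED-VERTEX COUNT**: `w ∣ v` ramified non-split, `α ∈ L_w` an anti-fixed UNIT (`σ_w α = −α`, `|α| = 1` —
the wild places of type `L⁺_v(√u)`, `d` even), `ϖ_F` a uniformiser of `L⁺_v`; for `γ₂ ∈ U₂ = U(Φ₂)(L⁺_v)` and any descent representative `(s, g)` of `E₂ γ₂` (`diag(1,α) E₂γ₂ diag(1,α)⁻¹ =
s · ι_w(g)`, ★ `exists_conj_diagonal_eq_smul_map_toPlace`): **`#Fix_{γ₂}(U₂ ⧸ K₂) = #{x | g·x = x}`**, `K₂ = U(Φ₂)(𝒪_v)` the integral level, `x` over the vertices of the tree of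
`SL₂(L⁺_v)`.  (§2 then §1.)  With ★ p855119 this reads `Φ^st(γ_H, hFamily 0) = ν_H(K₂ × U₁) · #{x | g·x = x}` on the type-(2) population at a √u-type place; the ball census of
`{x | g·x = x}` by the conductor of the eigen-order of `g` is the (ii-H) type-(2) law debt. [cite: Tits1979, §2.7 p. 48, §3.2 p. 50] [cite: Serre1980Trees, Ch. I §6.1; Ch. II §1.3]
[cite: Kottwitz1988, §2] [cite: LabesseLanglands1979, §2 p. 8] -/
theorem natCard_fixedBy_cmLocalIntegralLevel_eq_ncard_setOf_glVertexAct_of_v_eq_one (he : v.asIdeal.ramificationIdx' w.1.asIdeal ≠ 1) (hvα : Valued.v α = 1)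
    (γ₂ : ((cmDatum L 2 (Matrix.of fun i j : Fin 2 => if i.val + j.val + 1 = 2 then (1 : L) else 0)).Local v))
    {s : w.1.adicCompletion L} {g : GL (Fin 2) (v.adicCompletion ↥(maximalRealSubfield L))} (hs : s ≠ 0)
    (hsg : Matrix.diagonal ![1, α] * ((((localNonsplitEquiv (IsCMField.complexConj L) (Matrix.of fun i j : Fin 2 => if i.val + j.val + 1 = 2 then (1 : L) else 0) (IsCMField.complexConj_ne_one L) w hw) γ₂ : ↥(unitaryGroupOfForm (galAdicCompletionMap (L := L) (IsCMField.complexConj L) hw) (placeForm (Matrix.of fun i j : Fin 2 => if i.val + j.val + 1 = 2 then (1 : L) else 0) w.1))) : GL (Fin 2) (w.1.adicCompletion L)) : Matrix (Fin 2) (Fin 2) (w.1.adicCompletion L)) * Matrix.diagonal ![1, α⁻¹] =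
      s • (g : Matrix (Fin 2) (Fin 2) (v.adicCompletion ↥(maximalRealSubfield L))).map (toPlace v w)) :
    Nat.card (fixedBy (((cmDatum L 2 (Matrix.of fun i j : Fin 2 => if i.val + j.val + 1 = 2 then (1 : L) else 0)).Local v) ⧸
        cmLocalIntegralLevel L 2 (Matrix.of fun i j : Fin 2 => if i.val + j.val + 1 = 2 then (1 : L) else 0) v) γ₂) =
      {x : {M : Submodule 𝒪[v.adicCompletion ↥(maximalRealSubfield L)] (Fin 2 → v.adicCompletion ↥(maximalRealSubfield L)) //
        IsSpecialLattice (RingHom.id _) ϖF !![(0 : v.adicCompletion ↥(maximalRealSubfield L)), 1; -1, 0] M} |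
          glVertexAct (isUniformizingElement_of_v_eq hϖF) g x = x}.ncard := by
  rw [natCard_fixedBy_cmLocalIntegralLevel_eq_ncard_fixedBy_onePlace L v w hw γ₂]
  exact ncard_fixedBy_quotient_comap_glInt_eq_ncard_setOf_glVertexAct L v w hw hα hα0 hϖF he hvα _ hs hsg

end Place

end Literature.NumberTheory.Automorphic.UnitaryGroup

end
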